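import Summits.HodgeConjecture.CorCM.IrreducibleOddWeightsCommutantLines
import Summits.HodgeConjecture.CorCM.IrreducibleOddWeightsIsotypicDensity
import HarnessLib

/-!
# Density over the commutant, III: DENSITY FOR D-FREE TUPLES and THE DIMENSION FORMULA
# `dim 𝔐(b) · δ = dim D⟨b⟩ · dim A` for the diagonal orbit module of ANY tuple in a stable irreducible `A`

COR-CM (cell `pub-hodgecm2`, binder seat `b16` gen 72, count-neutral claim DENSITY OVER THE COMMUTANT, file C3 —
pure linear algebra; theorems only, no definition, no named fact, no `sorry`).  NEW as organised here, hence under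
`Summits/`.  HONEST FRAMING: the Jacobson DENSITY THEOREM in the lane's unbundled shape (one ℚ-space `V`, a family
of operators `T_i` closed under composition with identity, `A` stable IRREDUCIBLE — NO hypothesis on the commutant),
proved with file I1's complement lemma and equivariant projections; gen 70's file I8
(`IrreducibleOddWeightsIsotypicDensity`) is the case of a scalar commutant (`δ = 1`, `D⟨b⟩ = span_ℚ{b_j}`).  It
turns file I5's quantisation `d ∣ dim` into an exact count for ANY irreducible constituent; `HC_CM` is neither used
nor asserted; nothing here mentions CM fields.

SETTING (files C1/C2).  Commutant `𝒟` (a parameter with its characterising hypothesis `h𝒟`), D-lines `D·a`, D-spans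
`D⟨b⟩ = ⨆_j D·b_j`, `δ = dim D·a₀` (`0 ≠ a₀ ∈ A`); the DIAGONAL ORBIT MODULE of `b : J → A` is
`𝔐(b) = span{(T_i b_j)_j : i} ≤ A^J` (file I8).

* §1 Every element of `𝔐(b)` is `(φ b_j)_j` with `φ` IN THE SPAN of the operators.
* §2 **DENSITY** (`span_diag_orbit_eq_pi_of_free`): **`b` D-FREE ⟹ `𝔐(b) = A^J`** — otherwise a complementary
  cell and the equivariant projection onto it produce maps `L_j ∈ 𝒟` with `Σ_j L_j b_j = 0` and `L_s = id` on `A`.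
* §3 **THE DIMENSION FORMULA** (`finrank_span_diag_orbit_mul_eq`): for EVERY tuple `b : J → A`,
  **`dim 𝔐(b) · δ = dim D⟨b⟩ · dim A`**; more precisely there is `r ≤ |J|` (the D-RANK of `b`: the size of a maximal
  D-free sub-tuple, file C2) with `dim D⟨b⟩ = r·δ` and `dim 𝔐(b) = r·dim A` (`exists_rank_finrank_eq`): restriction to
  a maximal D-free sub-tuple is injective on `𝔐(b)` (an operator in `span(T)` killing the sub-tuple kills `D⟨b⟩`)
  and onto `A^r` by density.  Hence `dim A ∣ dim 𝔐(b)` and `δ ∣ dim D⟨b⟩`.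
* §4 `A` is a D-space: **`δ ∣ dim W` for every `𝒟`-stable `W ≤ A`** (`finrank_map_applyₗ_dvd_finrank_of_stable`), in
  particular `δ ∣ dim(D⟨b⟩ ∩ D⟨b′⟩)`.
File C4 (`…CommutantDensityShadows`) reads this on shadows: `dim(S(w₀) ∩ S(w₁))·δ = dim(D⟨b⟩ ∩ D⟨b′⟩)·dim A`.

## References

* [Lang2002] S. Lang, *Algebra*, 3rd ed., XVII §3 (the density theorem, Thm. 3.2; Cor. 3.3–3.4).
* [CurtisReiner1962] C. W. Curtis, I. Reiner, *Representation Theory of Finite Groups and Associative Algebras*,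
  §27 ((27.8) density).
* [Serre1977] J.-P. Serre, *Linear Representations of Finite Groups*, GTM 42, §2.2, §2.6.
-/

set_option autoImplicit false

noncomputable section

open scoped BigOperators Classical

universe u u' v w

namespace Summit.HodgeConjecture.CorCM.IrrOdd

variable {V : Type v} [AddCommGroup V] [Module ℚ V] {ι : Type w} (T : ι → V →ₗ[ℚ] V)

/-! ### §1 Elements of the diagonal orbit module -/

/-- Every element of `𝔐(b) = span{(T_i b_j)_j}` is `(φ b_j)_j` for some `φ` in the SPAN of the operators.
[folklore] -/
theorem exists_mem_span_range_of_mem_span_diag_orbit {J : Type u} (b : J → V) {f : J → V}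
    (hf : f ∈ Submodule.span ℚ (Set.range fun i : ι => fun j : J => T i (b j))) :
    ∃ φ ∈ Submodule.span ℚ (Set.range T), f = fun j => φ (b j) := by
  induction hf using Submodule.span_induction with
  | mem f hf =>
    obtain ⟨i, rfl⟩ := hf
    exact ⟨T i, Submodule.subset_span ⟨i, rfl⟩, rfl⟩
  | zero => exact ⟨0, Submodule.zero_mem _, funext fun j => by simp⟩
  | add f f' _ _ hf hf' =>
    obtain ⟨φ, hφ, rfl⟩ := hf
    obtain ⟨φ', hφ', rfl⟩ := hf'
    exact ⟨φ + φ', Submodule.add_mem _ hφ hφ', funext fun j => by simp⟩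
  | smul t f _ hf =>
    obtain ⟨φ, hφ, rfl⟩ := hf
    exact ⟨t • φ, Submodule.smul_mem _ t hφ, funext fun j => by simp⟩

/-! ### §2 Density for D-free tuples -/

/-- **DENSITY OVER THE COMMUTANT.**  `T` closed under composition and containing the identity; `A` finite-dimensional,
stable, IRREDUCIBLE (no hypothesis on its commutant `𝒟`); `b : J → A` a D-FREE tuple (`Σ_j L_j b_j = 0` with
`L_j ∈ 𝒟` forces every `L_j` to vanish on `A`).  Then the diagonal orbit module is everything:
**`span{(T_i b_j)_j : i} = A^J`** (Jacobson: the `T_i|_A` span `End_D(A)`).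
[cite: Lang2002, XVII §3] [cite: CurtisReiner1962, §27 (27.8)] -/
theorem span_diag_orbit_eq_pi_of_free {𝒟 : Submodule ℚ (V →ₗ[ℚ] V)} {A : Submodule ℚ V}
    [FiniteDimensional ℚ A]
    (h𝒟 : ∀ L : V →ₗ[ℚ] V, L ∈ 𝒟 ↔ (∀ a ∈ A, L a ∈ A) ∧ ∀ (i : ι) (a : V), a ∈ A → L (T i a) = T i (L a))
    (h1 : ∃ i₀ : ι, T i₀ = LinearMap.id) (hmul : ∀ i i' : ι, ∃ i'' : ι, T i'' = T i ∘ₗ T i')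
    (hAst : ∀ (i : ι) (v : V), v ∈ A → T i v ∈ A)
    (hAirr : ∀ W : Submodule ℚ V, W ≤ A → W ≠ ⊥ → (∀ (i : ι) (v : V), v ∈ W → T i v ∈ W) → W = A)
    {J : Type u} [Fintype J] {b : J → V} (hb : ∀ j, b j ∈ A)
    (hfree : ∀ L : J → (V →ₗ[ℚ] V), (∀ j, L j ∈ 𝒟) → ∑ j, L j (b j) = 0 →
      ∀ (j : J) (a : V), a ∈ A → L j a = 0) :
    Submodule.span ℚ (Set.range fun i : ι => fun j : J => T i (b j)) = Submodule.pi Set.univ (fun _ : J => A) := by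
  -- the degenerate case `A = 0`
  by_cases hA : A = ⊥
  · subst hA
    have hb0 : ∀ j, b j = 0 := fun j => (Submodule.mem_bot ℚ).1 (hb j)
    refine le_antisymm ?_ ?_
    · rw [Submodule.span_le]
      rintro _ ⟨i, rfl⟩ j -
      show T i (b j) ∈ (⊥ : Submodule ℚ V)
      rw [hb0 j, map_zero]
      exact Submodule.zero_mem _
    · intro f hf
      have h0 : f = 0 := funext fun j => (Submodule.mem_bot ℚ).1 (hf j trivial)
      rw [h0]
      exact Submodule.zero_mem _
  -- the tuple space with its diagonal operators and cells
  let TJ : ι → (J → V) →ₗ[ℚ] (J → V) := fun i => (T i).compLeft J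
  let N : J → Submodule ℚ (J → V) := fun j => A.map (LinearMap.single ℚ (fun _ : J => V) j)
  set 𝔐 := Submodule.span ℚ (Set.range fun i : ι => fun j : J => T i (b j)) with h𝔐
  have hNst : ∀ (j : J) (i : ι) (f : J → V), f ∈ N j → TJ i f ∈ N j :=
    fun j => (single_cell_irreducible T hAst hAirr j).1
  have hNirr : ∀ (j : J) (W : Submodule ℚ (J → V)), W ≤ N j → W ≠ ⊥ →
      (∀ (i : ι) (f : J → V), f ∈ W → TJ i f ∈ W) → W = N j := fun j => (single_cell_irreducible T hAst hAirr j).2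
  haveI : ∀ j, FiniteDimensional ℚ (N j) := fun j => Module.Finite.map _ _
  have h𝔐st : ∀ (i : ι) (f : J → V), f ∈ 𝔐 → TJ i f ∈ 𝔐 := span_diag_orbit_stable T hmul b
  have hpi : (⨆ j, N j) = Submodule.pi Set.univ (fun _ : J => A) := Submodule.iSup_map_single
  have h𝔐le : 𝔐 ≤ ⨆ j, N j := by
    rw [hpi, h𝔐, Submodule.span_le]
    rintro _ ⟨i, rfl⟩ j -
    exact hAst i _ (hb j)
  haveI : FiniteDimensional ℚ 𝔐 := Submodule.finiteDimensional_of_le h𝔐le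
  -- a complementary family of cells
  obtain ⟨S, hdisj, hsup, -⟩ := exists_finset_compl_of_stable_le_iSup TJ hNst hNirr h𝔐st h𝔐le
  rw [← hpi]
  by_cases hS : S = ∅
  · subst hS
    rw [Finset.sup_empty, sup_bot_eq] at hsup
    exact hsup
  exfalso
  obtain ⟨s, hs⟩ := Finset.nonempty_iff_ne_empty.2 hS
  -- the equivariant projection onto `S.sup N` along `𝔐`
  have hQst := stable_finset_sup TJ N hNst S
  obtain ⟨π, hπmem, hπid, hπzero, -, hπeq⟩ :=
    exists_proj_of_inf_eq_bot TJ hQst h𝔐st (by rw [inf_comm]; exact hdisj)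
  have hsupQ : S.sup N ⊔ 𝔐 = ⨆ j, N j := by rw [sup_comm]; exact hsup
  have hQle : S.sup N ≤ Submodule.pi Set.univ (fun _ : J => A) := by
    rw [← hpi]
    exact Finset.sup_le fun j _ => le_iSup N j
  have hsingle_mem : ∀ (j : J) (a : V), a ∈ A → LinearMap.single ℚ (fun _ : J => V) j a ∈ S.sup N ⊔ 𝔐 := by
    intro j a ha
    rw [hsupQ]
    exact Submodule.mem_iSup_of_mem j ⟨a, ha, rfl⟩
  -- the maps `L_j = proj_s ∘ π ∘ single_j` lie in the commutant
  have hL : ∀ j : J, (LinearMap.proj s ∘ₗ π ∘ₗ LinearMap.single ℚ (fun _ : J => V) j) ∈ 𝒟 := by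
    intro j
    refine (h𝒟 _).2 ⟨fun a _ => ?_, fun i a ha => ?_⟩
    · have hmem : π (LinearMap.single ℚ (fun _ : J => V) j a) ∈ Submodule.pi Set.univ (fun _ : J => A) :=
        hQle (hπmem _)
      exact (Submodule.mem_pi.1 hmem) s trivial
    · simp only [LinearMap.coe_comp, Function.comp_apply, LinearMap.coe_proj, Function.eval]
      rw [← compLeft_single T i j a, hπeq i _ (hsingle_mem j a ha)]
      rfl
  -- `L_s = id` on `A`: `π` is the identity on the cell `single_s(A) ≤ S.sup N`
  have hLs : ∀ a ∈ A, (LinearMap.proj s ∘ₗ π ∘ₗ LinearMap.single ℚ (fun _ : J => V) s) a = a := by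
    intro a ha
    simp only [LinearMap.coe_comp, Function.comp_apply, LinearMap.coe_proj, Function.eval]
    rw [hπid _ ((Finset.le_sup hs : N s ≤ S.sup N) ⟨a, ha, rfl⟩)]
    simp
  -- `π` kills the tuple `b ∈ 𝔐`; its `s`-coordinate is `Σ_j L_j b_j`
  obtain ⟨i₀, hi₀⟩ := h1
  have hbmem : (fun j => b j) ∈ 𝔐 := Submodule.subset_span ⟨i₀, funext fun j => by simp [hi₀]⟩
  have hsum : ∑ j, (LinearMap.proj s ∘ₗ π ∘ₗ LinearMap.single ℚ (fun _ : J => V) j) (b j) = 0 := by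
    have h0 : (LinearMap.proj s ∘ₗ π) (fun j => b j) = 0 := by
      simp only [LinearMap.coe_comp, Function.comp_apply, hπzero _ hbmem]
      rfl
    have hdec : (fun j => b j) = ∑ j, LinearMap.single ℚ (fun _ : J => V) j (b j) := by
      simp only [LinearMap.coe_single]
      exact (LinearMap.sum_single_apply (fun _ : J => V) (fun j => b j)).symm
    rw [hdec, map_sum] at h0
    rw [← h0]
    exact Finset.sum_congr rfl fun j _ => rfl
  -- D-freeness: `L_s = 0` on `A ≠ 0`, a contradiction
  have hzero := hfree _ hL hsum s
  obtain ⟨a, ha, ha0⟩ := Submodule.exists_mem_ne_zero_of_ne_bot hA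
  exact ha0 ((hLs a ha).symm.trans (hzero a ha))

/-- **DENSITY, DIMENSION FORM**: a D-free tuple of length `n` has `dim 𝔐(b) = n · dim A`.
[cite: Lang2002, XVII §3] -/
theorem finrank_span_diag_orbit_eq_card_mul_of_free {𝒟 : Submodule ℚ (V →ₗ[ℚ] V)} {A : Submodule ℚ V}
    [FiniteDimensional ℚ A]
    (h𝒟 : ∀ L : V →ₗ[ℚ] V, L ∈ 𝒟 ↔ (∀ a ∈ A, L a ∈ A) ∧ ∀ (i : ι) (a : V), a ∈ A → L (T i a) = T i (L a))
    (h1 : ∃ i₀ : ι, T i₀ = LinearMap.id) (hmul : ∀ i i' : ι, ∃ i'' : ι, T i'' = T i ∘ₗ T i')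
    (hAst : ∀ (i : ι) (v : V), v ∈ A → T i v ∈ A)
    (hAirr : ∀ W : Submodule ℚ V, W ≤ A → W ≠ ⊥ → (∀ (i : ι) (v : V), v ∈ W → T i v ∈ W) → W = A)
    {J : Type u} [Fintype J] {b : J → V} (hb : ∀ j, b j ∈ A)
    (hfree : ∀ L : J → (V →ₗ[ℚ] V), (∀ j, L j ∈ 𝒟) → ∑ j, L j (b j) = 0 →
      ∀ (j : J) (a : V), a ∈ A → L j a = 0) :
    Module.finrank ℚ ↥(Submodule.span ℚ (Set.range fun i : ι => fun j : J => T i (b j))) =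
      Fintype.card J * Module.finrank ℚ A := by
  rw [span_diag_orbit_eq_pi_of_free T h𝒟 h1 hmul hAst hAirr hb hfree, finrank_pi_const_eq]

/-! ### §3 The dimension formula -/

/-- **RESTRICTION TO A D-SPANNING SUB-TUPLE IS INJECTIVE ON `𝔐(b)`**: if every `b_j` lies in `D⟨b|_S⟩` then
`dim 𝔐(b) = dim 𝔐(b|_S)` (an element `(φ b_j)_j`, `φ ∈ span(T)`, vanishing on the sub-tuple vanishes on its D-span,
file C2). [cite: Lang2002, XVII §3] -/
theorem finrank_span_diag_orbit_eq_of_forall_mem {𝒟 : Submodule ℚ (V →ₗ[ℚ] V)} {A : Submodule ℚ V}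
    [FiniteDimensional ℚ A]
    (h𝒟 : ∀ L : V →ₗ[ℚ] V, L ∈ 𝒟 ↔ (∀ a ∈ A, L a ∈ A) ∧ ∀ (i : ι) (a : V), a ∈ A → L (T i a) = T i (L a))
    (hAst : ∀ (i : ι) (v : V), v ∈ A → T i v ∈ A)
    {J : Type u} [Fintype J] {b : J → V} (hb : ∀ j, b j ∈ A) (S : Finset J)
    (hS : ∀ j, b j ∈ ⨆ k : ↥S, 𝒟.map (LinearMap.applyₗ (b k))) :
    Module.finrank ℚ ↥(Submodule.span ℚ (Set.range fun i : ι => fun j : J => T i (b j))) =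
      Module.finrank ℚ ↥(Submodule.span ℚ (Set.range fun i : ι => fun k : ↥S => T i (b k))) := by
  let ρ : (J → V) →ₗ[ℚ] (↥S → V) := LinearMap.funLeft ℚ V ((↑) : ↥S → J)
  have hmap : (Submodule.span ℚ (Set.range fun i : ι => fun j : J => T i (b j))).map ρ =
      Submodule.span ℚ (Set.range fun i : ι => fun k : ↥S => T i (b k)) := by
    rw [Submodule.map_span, ← Set.range_comp]
    rfl
  -- injectivity on `𝔐(b)`
  have hinj : ∀ f ∈ Submodule.span ℚ (Set.range fun i : ι => fun j : J => T i (b j)), ρ f = 0 → f = 0 := by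
    intro f hf h0
    obtain ⟨φ, hφ, rfl⟩ := exists_mem_span_range_of_mem_span_diag_orbit T b hf
    have hk : ∀ k : ↥S, φ (b k) = 0 := fun k => congrFun h0 k
    funext j
    exact apply_eq_zero_of_mem_iSup_map_applyₗ T h𝒟 hφ (fun k : ↥S => hb k) hk (hS j)
  rw [← hmap, ← LinearMap.range_domRestrict]
  have hk : LinearMap.ker (ρ.domRestrict (Submodule.span ℚ (Set.range fun i : ι => fun j : J => T i (b j)))) =
      ⊥ := by
    rw [eq_bot_iff]
    intro f hf
    rw [Submodule.mem_bot]
    exact Subtype.ext (hinj f f.2 hf)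
  haveI : ∀ j : J, FiniteDimensional ℚ ↥(A.map (LinearMap.single ℚ (fun _ : J => V) j)) := fun j =>
    Module.Finite.map _ _
  haveI : FiniteDimensional ℚ ↥(Submodule.span ℚ (Set.range fun i : ι => fun j : J => T i (b j))) :=
    Submodule.finiteDimensional_of_le
      (show _ ≤ ⨆ j : J, A.map (LinearMap.single ℚ (fun _ : J => V) j) by
        rw [Submodule.iSup_map_single, Submodule.span_le]
        rintro _ ⟨i, rfl⟩ j -
        exact hAst i _ (hb j))
  have h := LinearMap.finrank_range_add_finrank_ker
    (ρ.domRestrict (Submodule.span ℚ (Set.range fun i : ι => fun j : J => T i (b j))))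
  rw [hk, finrank_bot, add_zero] at h
  exact h.symm

/-- **THE D-RANK.**  Every tuple `b : J → A` (`A` finite-dimensional stable irreducible, `T` closed under
composition with identity, `0 ≠ a₀ ∈ A`) has a D-RANK `r ≤ |J|` with **`dim D⟨b⟩ = r · δ` and `dim 𝔐(b) = r · dim A`**
(`r` = the length of a maximal D-free sub-tuple). [cite: Lang2002, XVII §3] [cite: CurtisReiner1962, §27 (27.8)] -/
theorem exists_rank_finrank_eq {𝒟 : Submodule ℚ (V →ₗ[ℚ] V)} {A : Submodule ℚ V} [FiniteDimensional ℚ A]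
    (h𝒟 : ∀ L : V →ₗ[ℚ] V, L ∈ 𝒟 ↔ (∀ a ∈ A, L a ∈ A) ∧ ∀ (i : ι) (a : V), a ∈ A → L (T i a) = T i (L a))
    (h1 : ∃ i₀ : ι, T i₀ = LinearMap.id) (hmul : ∀ i i' : ι, ∃ i'' : ι, T i'' = T i ∘ₗ T i')
    (hAst : ∀ (i : ι) (v : V), v ∈ A → T i v ∈ A)
    (hAirr : ∀ W : Submodule ℚ V, W ≤ A → W ≠ ⊥ → (∀ (i : ι) (v : V), v ∈ W → T i v ∈ W) → W = A)
    {J : Type u} [Fintype J] {b : J → V} (hb : ∀ j, b j ∈ A) {a₀ : V} (ha₀ : a₀ ∈ A) (h0 : a₀ ≠ 0) :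
    ∃ r : ℕ, r ≤ Fintype.card J ∧
      Module.finrank ℚ ↥(⨆ j, 𝒟.map (LinearMap.applyₗ (b j))) =
        r * Module.finrank ℚ ↥(𝒟.map (LinearMap.applyₗ a₀)) ∧
      Module.finrank ℚ ↥(Submodule.span ℚ (Set.range fun i : ι => fun j : J => T i (b j))) =
        r * Module.finrank ℚ A := by
  obtain ⟨S, hSfree, hS⟩ := exists_free_subfamily T h𝒟 hAst hAirr hb
  refine ⟨S.card, Finset.card_le_univ S, ?_, ?_⟩
  · rw [iSup_map_applyₗ_eq_of_forall_mem T h𝒟 b S hS,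
      finrank_iSup_map_applyₗ_eq_card_mul_of_free T h𝒟 h1 hmul hAst hAirr (fun k : ↥S => hb k) hSfree ha₀ h0,
      Fintype.card_coe]
  · rw [finrank_span_diag_orbit_eq_of_forall_mem T h𝒟 hAst hb S hS,
      finrank_span_diag_orbit_eq_card_mul_of_free T h𝒟 h1 hmul hAst hAirr (fun k : ↥S => hb k) hSfree,
      Fintype.card_coe]

/-- **THE DIMENSION FORMULA: `dim 𝔐(b) · δ = dim D⟨b⟩ · dim A`** for EVERY tuple `b : J → A` (`A` finite-dimensional
stable irreducible, `T` closed under composition with identity, `δ = dim D·a₀` for any `0 ≠ a₀ ∈ A`).  Scalar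
commutant: `δ = 1`, `D⟨b⟩ = span_ℚ{b_j}` — file I8's `dim 𝔐(b) = rank(b) · dim A`.
[cite: Lang2002, XVII §3] [cite: CurtisReiner1962, §27 (27.8)] [cite: Serre1977, §2.6] -/
theorem finrank_span_diag_orbit_mul_eq {𝒟 : Submodule ℚ (V →ₗ[ℚ] V)} {A : Submodule ℚ V} [FiniteDimensional ℚ A]
    (h𝒟 : ∀ L : V →ₗ[ℚ] V, L ∈ 𝒟 ↔ (∀ a ∈ A, L a ∈ A) ∧ ∀ (i : ι) (a : V), a ∈ A → L (T i a) = T i (L a))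
    (h1 : ∃ i₀ : ι, T i₀ = LinearMap.id) (hmul : ∀ i i' : ι, ∃ i'' : ι, T i'' = T i ∘ₗ T i')
    (hAst : ∀ (i : ι) (v : V), v ∈ A → T i v ∈ A)
    (hAirr : ∀ W : Submodule ℚ V, W ≤ A → W ≠ ⊥ → (∀ (i : ι) (v : V), v ∈ W → T i v ∈ W) → W = A)
    {J : Type u} [Fintype J] {b : J → V} (hb : ∀ j, b j ∈ A) {a₀ : V} (ha₀ : a₀ ∈ A) (h0 : a₀ ≠ 0) :
    Module.finrank ℚ ↥(Submodule.span ℚ (Set.range fun i : ι => fun j : J => T i (b j))) *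
        Module.finrank ℚ ↥(𝒟.map (LinearMap.applyₗ a₀)) =
      Module.finrank ℚ ↥(⨆ j, 𝒟.map (LinearMap.applyₗ (b j))) * Module.finrank ℚ A := by
  obtain ⟨r, -, hD, hM⟩ := exists_rank_finrank_eq T h𝒟 h1 hmul hAst hAirr hb ha₀ h0
  rw [hD, hM]
  ring

/-- `dim A ∣ dim 𝔐(b)` (no hypothesis on the commutant; `A ≠ 0`). [cite: Lang2002, XVII §3] -/
theorem finrank_dvd_finrank_span_diag_orbit {𝒟 : Submodule ℚ (V →ₗ[ℚ] V)} {A : Submodule ℚ V}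
    [FiniteDimensional ℚ A]
    (h𝒟 : ∀ L : V →ₗ[ℚ] V, L ∈ 𝒟 ↔ (∀ a ∈ A, L a ∈ A) ∧ ∀ (i : ι) (a : V), a ∈ A → L (T i a) = T i (L a))
    (h1 : ∃ i₀ : ι, T i₀ = LinearMap.id) (hmul : ∀ i i' : ι, ∃ i'' : ι, T i'' = T i ∘ₗ T i')
    (hAst : ∀ (i : ι) (v : V), v ∈ A → T i v ∈ A)
    (hAirr : ∀ W : Submodule ℚ V, W ≤ A → W ≠ ⊥ → (∀ (i : ι) (v : V), v ∈ W → T i v ∈ W) → W = A)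
    (hA : A ≠ ⊥) {J : Type u} [Fintype J] {b : J → V} (hb : ∀ j, b j ∈ A) :
    Module.finrank ℚ A ∣ Module.finrank ℚ ↥(Submodule.span ℚ (Set.range fun i : ι => fun j : J => T i (b j))) := by
  obtain ⟨a₀, ha₀, h0⟩ := Submodule.exists_mem_ne_zero_of_ne_bot hA
  obtain ⟨r, -, -, hM⟩ := exists_rank_finrank_eq T h𝒟 h1 hmul hAst hAirr hb ha₀ h0
  exact ⟨r, by rw [hM, mul_comm]⟩

/-- `δ ∣ dim D⟨b⟩`. [cite: Lang2002, XVII §1] -/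
theorem finrank_map_applyₗ_dvd_finrank_iSup {𝒟 : Submodule ℚ (V →ₗ[ℚ] V)} {A : Submodule ℚ V}
    [FiniteDimensional ℚ A]
    (h𝒟 : ∀ L : V →ₗ[ℚ] V, L ∈ 𝒟 ↔ (∀ a ∈ A, L a ∈ A) ∧ ∀ (i : ι) (a : V), a ∈ A → L (T i a) = T i (L a))
    (h1 : ∃ i₀ : ι, T i₀ = LinearMap.id) (hmul : ∀ i i' : ι, ∃ i'' : ι, T i'' = T i ∘ₗ T i')
    (hAst : ∀ (i : ι) (v : V), v ∈ A → T i v ∈ A)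
    (hAirr : ∀ W : Submodule ℚ V, W ≤ A → W ≠ ⊥ → (∀ (i : ι) (v : V), v ∈ W → T i v ∈ W) → W = A)
    {J : Type u} [Fintype J] {b : J → V} (hb : ∀ j, b j ∈ A) {a₀ : V} (ha₀ : a₀ ∈ A) (h0 : a₀ ≠ 0) :
    Module.finrank ℚ ↥(𝒟.map (LinearMap.applyₗ a₀)) ∣ Module.finrank ℚ ↥(⨆ j, 𝒟.map (LinearMap.applyₗ (b j))) := by
  obtain ⟨r, -, hD, -⟩ := exists_rank_finrank_eq T h𝒟 h1 hmul hAst hAirr hb ha₀ h0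
  exact ⟨r, by rw [hD, mul_comm]⟩

/-- **`𝔐(b) = A^J` ⟺ `b` is D-free** (for `A ≠ 0`): the converse of density — if `𝔐(b) = A^J` then
`dim D⟨b⟩ = |J|·δ`, i.e. no D-relation. Stated as: `dim 𝔐(b) = |J| · dim A ⟹ dim D⟨b⟩ = |J| · δ`.
[cite: Lang2002, XVII §3] -/
theorem finrank_iSup_map_applyₗ_eq_card_mul_of_finrank_eq {𝒟 : Submodule ℚ (V →ₗ[ℚ] V)} {A : Submodule ℚ V}
    [FiniteDimensional ℚ A]
    (h𝒟 : ∀ L : V →ₗ[ℚ] V, L ∈ 𝒟 ↔ (∀ a ∈ A, L a ∈ A) ∧ ∀ (i : ι) (a : V), a ∈ A → L (T i a) = T i (L a))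
    (h1 : ∃ i₀ : ι, T i₀ = LinearMap.id) (hmul : ∀ i i' : ι, ∃ i'' : ι, T i'' = T i ∘ₗ T i')
    (hAst : ∀ (i : ι) (v : V), v ∈ A → T i v ∈ A)
    (hAirr : ∀ W : Submodule ℚ V, W ≤ A → W ≠ ⊥ → (∀ (i : ι) (v : V), v ∈ W → T i v ∈ W) → W = A)
    {J : Type u} [Fintype J] {b : J → V} (hb : ∀ j, b j ∈ A) {a₀ : V} (ha₀ : a₀ ∈ A) (h0 : a₀ ≠ 0)
    (hM : Module.finrank ℚ ↥(Submodule.span ℚ (Set.range fun i : ι => fun j : J => T i (b j))) =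
      Fintype.card J * Module.finrank ℚ A) :
    Module.finrank ℚ ↥(⨆ j, 𝒟.map (LinearMap.applyₗ (b j))) =
      Fintype.card J * Module.finrank ℚ ↥(𝒟.map (LinearMap.applyₗ a₀)) := by
  obtain ⟨r, -, hD, hM'⟩ := exists_rank_finrank_eq T h𝒟 h1 hmul hAst hAirr hb ha₀ h0
  have hA : Module.finrank ℚ A ≠ 0 := fun h => h0 (by
    have hbot : A = ⊥ := Submodule.finrank_eq_zero.1 h
    exact (Submodule.mem_bot ℚ).1 (hbot ▸ ha₀))
  rw [hM'] at hM
  rw [hD, Nat.eq_of_mul_eq_mul_right (Nat.pos_of_ne_zero hA) hM]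

/-! ### §4 `A` is a D-space: every `𝒟`-stable subspace of `A` has dimension a multiple of `δ` -/

/-- **`δ ∣ dim W` FOR EVERY `𝒟`-STABLE `W ≤ A`** (`A` finite-dimensional stable irreducible, `T` closed under
composition with identity, `0 ≠ a₀ ∈ A`): `A` is the sum of the D-lines of a ℚ-basis, each `𝒟`-stable irreducible of
dimension `δ` — file I1's quantisation for the family `𝒟`.  (`W` is a `D`-subspace of the `D`-vector space `A`.)
[cite: Lang2002, XVII §1] [cite: CurtisReiner1962, §27 (27.3)] -/
theorem finrank_map_applyₗ_dvd_finrank_of_stable {𝒟 : Submodule ℚ (V →ₗ[ℚ] V)} {A : Submodule ℚ V}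
    [FiniteDimensional ℚ A]
    (h𝒟 : ∀ L : V →ₗ[ℚ] V, L ∈ 𝒟 ↔ (∀ a ∈ A, L a ∈ A) ∧ ∀ (i : ι) (a : V), a ∈ A → L (T i a) = T i (L a))
    (h1 : ∃ i₀ : ι, T i₀ = LinearMap.id) (hmul : ∀ i i' : ι, ∃ i'' : ι, T i'' = T i ∘ₗ T i')
    (hAst : ∀ (i : ι) (v : V), v ∈ A → T i v ∈ A)
    (hAirr : ∀ W : Submodule ℚ V, W ≤ A → W ≠ ⊥ → (∀ (i : ι) (v : V), v ∈ W → T i v ∈ W) → W = A)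
    {a₀ : V} (ha₀ : a₀ ∈ A) (h0 : a₀ ≠ 0) {W : Submodule ℚ V} (hW : W ≤ A)
    (hWst : ∀ (L : ↥𝒟) (v : V), v ∈ W → (L : V →ₗ[ℚ] V) v ∈ W) :
    Module.finrank ℚ ↥(𝒟.map (LinearMap.applyₗ a₀)) ∣ Module.finrank ℚ W := by
  let s := Module.finBasis ℚ A
  let N : Fin (Module.finrank ℚ A) → Submodule ℚ V := fun k => 𝒟.map (LinearMap.applyₗ (s k : V))
  haveI : ∀ k, FiniteDimensional ℚ (N k) := fun k =>
    Submodule.finiteDimensional_of_le (map_applyₗ_le T h𝒟 (s k).2)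
  haveI : FiniteDimensional ℚ W := Submodule.finiteDimensional_of_le hW
  have hNst : ∀ (k : Fin (Module.finrank ℚ A)) (L : ↥𝒟) (v : V), v ∈ N k → (L : V →ₗ[ℚ] V) v ∈ N k :=
    fun k => map_applyₗ_stable T h𝒟 (s k : V)
  have hNirr : ∀ (k : Fin (Module.finrank ℚ A)) (W' : Submodule ℚ V), W' ≤ N k → W' ≠ ⊥ →
      (∀ (L : ↥𝒟) (v : V), v ∈ W' → (L : V →ₗ[ℚ] V) v ∈ W') → W' = N k :=
    fun k => map_applyₗ_irreducible T h𝒟 hAst hAirr (s k).2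
  have hd : ∀ k, N k = ⊥ ∨ Module.finrank ℚ (N k) = Module.finrank ℚ ↥(𝒟.map (LinearMap.applyₗ a₀)) :=
    fun k => Or.inr (finrank_map_applyₗ_eq T h𝒟 h1 hmul hAst hAirr (s k).2
      (fun h => s.ne_zero k (Submodule.coe_eq_zero.1 h)) ha₀ h0)
  have hle : A ≤ ⨆ k, N k := by
    intro a ha
    have h : a = ∑ k, ((s.repr ⟨a, ha⟩ k • s k : A) : V) := by
      have h := congrArg Subtype.val (s.sum_repr ⟨a, ha⟩)
      rw [Submodule.coe_sum] at h
      exact h.symm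
    rw [h]
    refine Submodule.sum_mem _ fun k _ => ?_
    rw [Submodule.coe_smul]
    exact Submodule.smul_mem _ _ (Submodule.mem_iSup_of_mem k (self_mem_map_applyₗ T h𝒟 (s k : V)))
  exact dvd_finrank_of_stable_le_iSup (fun L : ↥𝒟 => (L : V →ₗ[ℚ] V)) hNst hNirr hd hWst (hW.trans hle)

/-- In particular **`δ ∣ dim(D⟨b⟩ ∩ D⟨b′⟩)`** for a tuple `b` in `A` and any tuple `b′`. [cite: Lang2002, XVII §1] -/
theorem finrank_map_applyₗ_dvd_finrank_iSup_inf_iSup {𝒟 : Submodule ℚ (V →ₗ[ℚ] V)} {A : Submodule ℚ V}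
    [FiniteDimensional ℚ A]
    (h𝒟 : ∀ L : V →ₗ[ℚ] V, L ∈ 𝒟 ↔ (∀ a ∈ A, L a ∈ A) ∧ ∀ (i : ι) (a : V), a ∈ A → L (T i a) = T i (L a))
    (h1 : ∃ i₀ : ι, T i₀ = LinearMap.id) (hmul : ∀ i i' : ι, ∃ i'' : ι, T i'' = T i ∘ₗ T i')
    (hAst : ∀ (i : ι) (v : V), v ∈ A → T i v ∈ A)
    (hAirr : ∀ W : Submodule ℚ V, W ≤ A → W ≠ ⊥ → (∀ (i : ι) (v : V), v ∈ W → T i v ∈ W) → W = A)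
    {a₀ : V} (ha₀ : a₀ ∈ A) (h0 : a₀ ≠ 0) {J₀ : Type u} {J₁ : Type u'} [Fintype J₀] [Fintype J₁]
    {b₀ : J₀ → V} (b₁ : J₁ → V) (hb₀ : ∀ j, b₀ j ∈ A) :
    Module.finrank ℚ ↥(𝒟.map (LinearMap.applyₗ a₀)) ∣
      Module.finrank ℚ ↥((⨆ j, 𝒟.map (LinearMap.applyₗ (b₀ j))) ⊓ ⨆ j, 𝒟.map (LinearMap.applyₗ (b₁ j))) :=
  finrank_map_applyₗ_dvd_finrank_of_stable T h𝒟 h1 hmul hAst hAirr ha₀ h0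
    (inf_le_left.trans (iSup_map_applyₗ_le T h𝒟 hb₀))
    (stable_inf (fun L : ↥𝒟 => (L : V →ₗ[ℚ] V)) (iSup_map_applyₗ_stable T h𝒟 b₀) (iSup_map_applyₗ_stable T h𝒟 b₁))

end Summit.HodgeConjecture.CorCM.IrrOdd

end
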